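import Summits.CriticalPhenomena.SAWScalingLimit.Theorems.ObservableToSLE.Negative.Identification
import Literature.Probability.RandomPlanarGeometry.SimpleCurves
import HarnessLib

/-!
# Uniform injectivity modulus from tightness and simplicity of subsequential limits

Stub `stub_hexUniformModulus_of_simpleLimits` (stub 5m_b of reshape r8) of the line
`bridge-gate-renewal` for the crux
`Summit.CriticalPhenomena.SAWScalingLimit.Theses.SAWDefectDecoherence.ObservableToSLER`
(item `stmt-CriticalPhenomena-14005`).  Reshape r8 splits the uniform injectivity modulus
`HexUniformModulus` of the critical hexagonal SAW (for all `ε, η > 0` some `θ > 0` such that for all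
small meshes the walks whose curve class lies outside `CurveClass.modulusClass ε θ` have mass `≤ η`)
into the crux's own hypothesis `HexTight` (tightness along the mesh) and the existing item
`HexSimpleSubseqLimits` (stmt-CriticalPhenomena-7148: every probability weak limit along a mesh
sequence is carried by simple classes).  This file proves the soft implication
`HexTight → HexSimpleSubseqLimits → HexUniformModulus` (all three inlined in the statement).

Proof.  Suppose for some `ε, η > 0` no `θ` works.  For `θ_j = 1/(j+1)` pick meshes
`δ_j ∈ (0, 1/(j+1))` at which the law is a probability measure and the bad event
`{curve ∉ modulusClass ε θ_j}` has mass `> η` (`Filter.Frequently` against the eventual facts).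
Prokhorov along the mesh sequence (`IsTightAlongMesh.exists_subseq`, through the Dirac padding of
the push-forward laws of `Negative/Identification.lean`) gives a subsequence converging weakly to a
probability measure `μ`, which by the second hypothesis is carried by simple classes.  A simple
class has an injectivity modulus `(ε/2, 1/(m+1))` for some `m`
(`Curve.IsSimple.exists_mem_modulusSet`), so by continuity from above some `m` has
`μ (modulusClass (ε/2) (1/(m+1)))ᶜ < η`.  KEY TOPOLOGICAL LEMMA
(`thickening_modulusClass_subset`): the open `r`-thickening of `modulusClass ε₂ θ₂` lies in
`modulusClass ε₁ θ₁` as soon as `2r + θ₁ ≤ θ₂` and `2r + ε₂ ≤ ε₁` (close classes have uniformly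
close parametrisations, `Curve.exists_dist_reparam_lt`).  Hence the complement `F` of a thin
thickening is a CLOSED set with `μ F < η` containing the bad event at `θ = 1/(2(m+1))`; the
closed-set half of the portmanteau theorem
(`ProbabilityMeasure.limsup_measure_closed_le_of_tendsto`) bounds the bad masses along the
subsequence eventually by `< η`, while by antitonicity of `modulusClass` in `θ` they are
eventually `> η` — contradiction.
-/

noncomputable section

open scoped BigOperators Topology NNReal ENNReal Classical BoundedContinuousFunction
open Filter Set MeasureTheory Metric
open Literature.Probability.LatticeModels (HexVertex hexGraph hexCenter)
open Literature.Probability.RandomPlanarGeometry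
open Literature.Probability.RandomPlanarGeometry.SAW

namespace Summit.CriticalPhenomena.SAWScalingLimit.Theorems.ObservableToSLER.Modulus

open Summit.CriticalPhenomena.SAWScalingLimit.Theorems.ObservableToSLE.Negative
  (eventually_isProbabilityMeasure_hexSAWLaw)

/-! ### Thickened modulus events -/

section Thickening

variable {E : Type*} [MetricSpace E]

/-- **Injectivity moduli are stable under uniform perturbation, with a loss**: if `γ` has modulus
`(ε₂, θ₂)` and `γ'` is at reparametrisation distance `< r` from `γ`, then `γ'` has modulus
`(ε₁, θ₁)` whenever `2r + θ₁ ≤ θ₂` and `2r + ε₂ ≤ ε₁` (reparametrise `γ` to be pointwise `r`-close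
to `γ'`, `Curve.exists_dist_reparam_lt`, and use the triangle inequality twice). -/
theorem mem_modulusSet_of_dist_lt {ε₁ ε₂ θ₁ θ₂ r : ℝ} {γ γ' : Curve E}
    (hγ : γ ∈ (Curve.modulusSet ε₂ θ₂ : Set (Curve E))) (hd : dist γ' γ < r)
    (hθ : 2 * r + θ₁ ≤ θ₂) (hε : 2 * r + ε₂ ≤ ε₁) :
    γ' ∈ (Curve.modulusSet ε₁ θ₁ : Set (Curve E)) := by
  obtain ⟨φ, hφ⟩ := Curve.exists_dist_reparam_lt hd
  have hmem := Curve.reparam_mem_modulusSet hγ φ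
  set γ'' := γ.reparam φ
  have hpt : ∀ x, dist (γ' x) (γ'' x) < r := fun x =>
    (ContinuousMap.dist_apply_le_dist (f := γ'.toContinuousMap) (g := γ''.toContinuousMap)
      x).trans_lt hφ
  intro s u t hsu hut hst
  have h1 : dist (γ'' s) (γ'' t) < θ₂ := by
    have h4 := dist_triangle4 (γ'' s) (γ' s) (γ' t) (γ'' t)
    have hs := hpt s
    have ht := hpt t
    rw [dist_comm] at hs
    linarith
  have h2 := hmem s u t hsu hut h1
  have h4 := dist_triangle4 (γ' s) (γ'' s) (γ'' u) (γ' u)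
  have hs := hpt s
  have hu := hpt u
  rw [dist_comm] at hu
  linarith

/-- **KEY TOPOLOGICAL LEMMA — thickened modulus events**: the open `r`-thickening of
`modulusClass ε₂ θ₂` is contained in `modulusClass ε₁ θ₁` whenever `2r + θ₁ ≤ θ₂` and
`2r + ε₂ ≤ ε₁` (membership of a class is membership of any representative,
`CurveClass.mk_mem_modulusClass_iff`, and `mem_modulusSet_of_dist_lt`). -/
theorem thickening_modulusClass_subset {ε₁ ε₂ θ₁ θ₂ r : ℝ}
    (hθ : 2 * r + θ₁ ≤ θ₂) (hε : 2 * r + ε₂ ≤ ε₁) :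
    thickening r (CurveClass.modulusClass ε₂ θ₂ : Set (CurveClass E)) ⊆
      CurveClass.modulusClass ε₁ θ₁ := by
  intro c hc
  rw [mem_thickening_iff] at hc
  obtain ⟨c', hc', hd⟩ := hc
  obtain ⟨γ', rfl⟩ := CurveClass.surjective_mk c
  obtain ⟨γ, rfl⟩ := CurveClass.surjective_mk c'
  rw [CurveClass.dist_mk_mk] at hd
  exact CurveClass.mk_mem_modulusClass_iff.2
    (mem_modulusSet_of_dist_lt (CurveClass.mk_mem_modulusClass_iff.1 hc') hd hθ hε)

end Thickening

/-! ### The limit side: a closed small set containing a bad event -/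

/-- **A law carried by simple classes charges the bad modulus events little, closedly**: if
`μ`-a.e. class is simple then for every `ε > 0` and `η > 0` there are `θ > 0` and a CLOSED set
`F ⊇ (modulusClass ε θ)ᶜ` with `μ F < η`.  Indeed the increasing closed events
`modulusClass (ε/2) (1/(m+1))` exhaust the simple classes (`Curve.IsSimple.exists_mem_modulusSet`),
so by continuity from above one of their complements has mass `< η`; `F` is the complement of a
thin open thickening of that event, which by `thickening_modulusClass_subset` still lies inside
`modulusClass ε (1/(2(m+1)))`. -/
theorem exists_isClosed_compl_modulusClass_subset {μ : Measure (CurveClass ℂ)} [IsFiniteMeasure μ]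
    {ε : ℝ} (hε : 0 < ε) (hae : ∀ᵐ c ∂μ, c ∈ CurveClass.simple) {η : ℝ≥0∞} (hη : 0 < η) :
    ∃ θ > (0 : ℝ), ∃ F : Set (CurveClass ℂ), IsClosed F ∧ μ F < η ∧
      (CurveClass.modulusClass ε θ)ᶜ ⊆ F := by
  -- the increasing events `M m = modulusClass (ε/2) (1/(m+1))` exhaust the simple classes
  set M : ℕ → Set (CurveClass ℂ) := fun m =>
    CurveClass.modulusClass (ε / 2) (1 / ((m : ℝ) + 1))
  have hcover : ∀ c ∈ (CurveClass.simple : Set (CurveClass ℂ)), c ∈ ⋃ m, M m := by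
    rintro _ ⟨γ, hγ, rfl⟩
    obtain ⟨θ, hθ, hmem⟩ := Curve.IsSimple.exists_mem_modulusSet hγ (half_pos hε)
    obtain ⟨m, hm⟩ := exists_nat_one_div_lt hθ
    exact mem_iUnion.2 ⟨m, CurveClass.mk_mem_modulusClass_iff.2
      (Curve.modulusSet_mono le_rfl hm.le hmem)⟩
  have hanti : Antitone fun m => (M m)ᶜ := by
    intro m m' hmm'
    refine compl_subset_compl.2 (CurveClass.modulusClass_mono le_rfl ?_)
    have h' : (m : ℝ) ≤ m' := Nat.cast_le.2 hmm'
    exact one_div_le_one_div_of_le (by positivity) (by linarith)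
  have hnull : μ (⋂ m, (M m)ᶜ) = 0 := by
    refine measure_mono_null ?_ (ae_iff.1 hae)
    intro c hc hcs
    obtain ⟨m, hm⟩ := mem_iUnion.1 (hcover c hcs)
    exact (mem_iInter.1 hc m) hm
  have htends : Tendsto (fun m => μ (M m)ᶜ) atTop (𝓝 (μ (⋂ m, (M m)ᶜ))) :=
    tendsto_measure_iInter_atTop
      (fun m => (CurveClass.isClosed_modulusClass _ _).isOpen_compl.measurableSet.nullMeasurableSet)
      hanti ⟨0, measure_ne_top μ _⟩
  rw [hnull] at htends
  obtain ⟨m, hm⟩ := (htends.eventually (gt_mem_nhds hη)).exists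
  -- the modulus parameter and the thickening radius
  set θ₂ : ℝ := 1 / ((m : ℝ) + 1)
  have hθ₂pos : 0 < θ₂ := Nat.one_div_pos_of_nat
  set r : ℝ := min (θ₂ / 4) (ε / 4)
  have hrpos : 0 < r := lt_min (by positivity) (by positivity)
  refine ⟨θ₂ / 2, half_pos hθ₂pos, (thickening r (M m))ᶜ, isOpen_thickening.isClosed_compl,
    ?_, ?_⟩
  · exact lt_of_le_of_lt (measure_mono (compl_subset_compl.2 (self_subset_thickening hrpos _))) hm
  · rw [compl_subset_compl]
    refine thickening_modulusClass_subset ?_ ?_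
    · have := min_le_left (θ₂ / 4) (ε / 4)
      linarith
    · have := min_le_right (θ₂ / 4) (ε / 4)
      linarith

/-! ### The stub -/

/-- **STUB 5m_b of the line `bridge-gate-renewal` (reshape r8) — the UNIFORM INJECTIVITY MODULUS
from TIGHTNESS and SIMPLICITY OF ALL SUBSEQUENTIAL LIMITS**:
`HexTight → HexSimpleSubseqLimits → HexUniformModulus`, all three inlined.  By contradiction: if
for some `ε, η > 0` no `θ` works, choose meshes `δ_j ∈ (0, 1/(j+1))` carrying probability laws with
bad mass `> η` at `θ_j = 1/(j+1)`; Prokhorov (`IsTightAlongMesh.exists_subseq` on the Dirac-padded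
push-forward laws) extracts a weakly convergent subsequence with probability limit `μ`, carried by
simple classes by the second hypothesis; `exists_isClosed_compl_modulusClass_subset` gives `θ > 0`
and a closed `F ⊇ (modulusClass ε θ)ᶜ` with `μ F < η`; portmanteau
(`ProbabilityMeasure.limsup_measure_closed_le_of_tendsto`) makes the mass of `{curve ∈ F}`
eventually `< η` along the subsequence, whereas for `θ_j ≤ θ` it dominates the bad mass at `θ_j`,
which is `> η`. -/
theorem stub_hexUniformModulus_of_simpleLimits :
    (∀ (D : DobrushinDomain) (a b : ℝ → HexVertex), IsEmbEndpointApprox hexGraph hexCenter D a b →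
      IsTightAlongMesh (fun δ (γ : HexDomainSAW D.carrier δ (a δ) (b δ)) => γ.curve)
        (fun δ => hexSAWLaw D.carrier δ (a δ) (b δ))) →
    (∀ (D : DobrushinDomain) (a b : ℝ → HexVertex), IsEmbEndpointApprox hexGraph hexCenter D a b →
      ∀ (s : ℕ → ℝ) (ν : Measure (CurveClass ℂ)), Tendsto s atTop (𝓝[>] 0) → IsProbabilityMeasure ν →
        (∀ f : CurveClass ℂ →ᵇ ℝ,
          Tendsto (fun n => ∫ γ, f γ.curve ∂(hexSAWLaw D.carrier (s n) (a (s n)) (b (s n)))) atTop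
            (𝓝 (∫ x, f x ∂ν))) →
        ∀ᵐ γ ∂ν, γ ∈ CurveClass.simple ∧ γ.source = D.pt 0 ∧ γ.target = D.pt 1 ∧
          γ.range ⊆ closure D.carrier ∧ γ.range ∩ frontier D.carrier ⊆ {D.pt 0, D.pt 1}) →
    ∀ (D : DobrushinDomain) (a b : ℝ → HexVertex), IsEmbEndpointApprox hexGraph hexCenter D a b →
      ∀ ε > (0 : ℝ), ∀ η > (0 : ℝ), ∃ θ > (0 : ℝ), ∀ᶠ δ : ℝ in 𝓝[>] 0,
        hexSAWLaw D.carrier δ (a δ) (b δ) {γ | γ.curve ∉ CurveClass.modulusClass ε θ} ≤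
          ENNReal.ofReal η := by
  intro hT hS D a b hab ε hε η hη
  by_contra H
  have hfreq : ∀ θ : ℝ, 0 < θ → ∃ᶠ δ in 𝓝[>] (0 : ℝ), ENNReal.ofReal η <
      hexSAWLaw D.carrier δ (a δ) (b δ) {γ | γ.curve ∉ CurveClass.modulusClass ε θ} :=
    fun θ hθ => (not_eventually.1 fun h => H ⟨θ, hθ, h⟩).mono fun δ hδ => not_le.1 hδ
  -- meshes `s j ∈ (0, 1/(j+1))` with probability laws and bad mass `> η` at `θ_j = 1/(j+1)`
  have hchoice : ∀ j : ℕ, ∃ δ : ℝ,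
      ENNReal.ofReal η < hexSAWLaw D.carrier δ (a δ) (b δ)
          {γ | γ.curve ∉ CurveClass.modulusClass ε (1 / ((j : ℝ) + 1))} ∧
        IsProbabilityMeasure (hexSAWLaw D.carrier δ (a δ) (b δ)) ∧
        δ ∈ Ioo (0 : ℝ) (1 / ((j : ℝ) + 1)) := fun j =>
    ((hfreq _ Nat.one_div_pos_of_nat).and_eventually
      ((eventually_isProbabilityMeasure_hexSAWLaw hab).and
        (Ioo_mem_nhdsGT Nat.one_div_pos_of_nat))).exists
  choose s hs_bad hs_prob hs_mem using hchoice
  have hs0 : Tendsto s atTop (𝓝[>] (0 : ℝ)) := by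
    refine tendsto_nhdsWithin_iff.2 ⟨?_, Eventually.of_forall fun j => (hs_mem j).1⟩
    exact squeeze_zero (fun j => (hs_mem j).1.le) (fun j => (hs_mem j).2.le)
      tendsto_one_div_add_atTop_nhds_zero_nat
  -- the push-forward laws, padded to probability measures (as in `Negative/Identification.lean`)
  have hmeas : ∀ δ, Measurable (fun γ : HexDomainSAW D.carrier δ (a δ) (b δ) => γ.curve) :=
    fun δ => EmbDomainSAW.measurable_of_top _
  let Q : ℝ → Measure (CurveClass ℂ) := fun δ =>
    (hexSAWLaw D.carrier δ (a δ) (b δ)).map fun γ : HexDomainSAW D.carrier δ (a δ) (b δ) => γ.curve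
  let c₀ : CurveClass ℂ := CurveClass.mk ⟨ContinuousMap.const _ 0⟩
  let Q' : ℝ → Measure (CurveClass ℂ) := fun δ =>
    if IsProbabilityMeasure (Q δ) then Q δ else Measure.dirac c₀
  haveI hQ' : ∀ δ, IsProbabilityMeasure (Q' δ) := fun δ => by
    by_cases h : IsProbabilityMeasure (Q δ)
    · simp only [Q', if_pos h]; exact h
    · simp only [Q', if_neg h]; infer_instance
  have hQ'eq : ∀ δ, IsProbabilityMeasure (hexSAWLaw D.carrier δ (a δ) (b δ)) → Q' δ = Q δ := by
    intro δ hδ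
    have : IsProbabilityMeasure (Q δ) := Measure.isProbabilityMeasure_map (hmeas δ).aemeasurable
    simp only [Q', if_pos this]
  have hev : ∀ᶠ δ in 𝓝[>] (0 : ℝ), Q' δ = Q δ :=
    (eventually_isProbabilityMeasure_hexSAWLaw hab).mono hQ'eq
  have hT' : IsTightAlongMesh (fun _ => (id : CurveClass ℂ → CurveClass ℂ)) Q' := by
    intro e he
    obtain ⟨K, hK, hKev⟩ := hT D a b hab e he
    refine ⟨K, hK, ?_⟩
    filter_upwards [hKev, hev] with δ h1 h2
    rw [h2, Set.preimage_id_eq, id,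
      Measure.map_apply (hmeas δ) hK.isClosed.isOpen_compl.measurableSet]
    exact h1
  -- Prokhorov along the mesh sequence `s`
  obtain ⟨φ, μ, hφ, hμ, hlim⟩ :=
    hT'.exists_subseq (Eventually.of_forall fun δ => aemeasurable_id) hs0
  have hQs : ∀ n, Q' (s (φ n)) = Q (s (φ n)) := fun n => hQ'eq _ (hs_prob (φ n))
  have hint : ∀ n (f : CurveClass ℂ →ᵇ ℝ), ∫ x, f x ∂Q' (s (φ n)) =
      ∫ ω, f ω.curve ∂hexSAWLaw D.carrier (s (φ n)) (a (s (φ n))) (b (s (φ n))) := by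
    intro n f
    rw [hQs n]
    exact integral_map (hmeas _).aemeasurable f.continuous.aestronglyMeasurable
  -- the limit is carried by simple classes (hypothesis 2)
  have hae := hS D a b hab (s ∘ φ) μ (hs0.comp hφ.tendsto_atTop) hμ fun f =>
    (hlim f).congr fun n => hint n f
  haveI := hμ
  obtain ⟨θ, hθ, F, hF, hμF, hsub⟩ := exists_isClosed_compl_modulusClass_subset (μ := μ) hε
    (hae.mono fun γ h => h.1) (ENNReal.ofReal_pos.2 hη)
  -- portmanteau for the closed set `F`
  let ν : ℕ → ProbabilityMeasure (CurveClass ℂ) := fun n => ⟨Q' (s (φ n)), hQ' _⟩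
  have hconv : Tendsto ν atTop (𝓝 (⟨μ, hμ⟩ : ProbabilityMeasure (CurveClass ℂ))) :=
    ProbabilityMeasure.tendsto_iff_forall_integral_tendsto.2 hlim
  have hlimsup := ProbabilityMeasure.limsup_measure_closed_le_of_tendsto hconv hF
  have hevF : ∀ᶠ n in atTop, (ν n : Measure (CurveClass ℂ)) F < ENNReal.ofReal η :=
    eventually_lt_of_limsup_lt (hlimsup.trans_lt hμF)
  have hevθ : ∀ᶠ n in atTop, 1 / ((φ n : ℝ) + 1) < θ :=
    (tendsto_one_div_add_atTop_nhds_zero_nat.comp hφ.tendsto_atTop).eventually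
      (eventually_lt_nhds hθ)
  obtain ⟨n, hnF, hnθ⟩ := (hevF.and hevθ).exists
  have key : ENNReal.ofReal η < Q' (s (φ n)) F :=
    calc ENNReal.ofReal η
        < hexSAWLaw D.carrier (s (φ n)) (a (s (φ n))) (b (s (φ n)))
            {γ | γ.curve ∉ CurveClass.modulusClass ε (1 / ((φ n : ℝ) + 1))} := hs_bad (φ n)
      _ ≤ hexSAWLaw D.carrier (s (φ n)) (a (s (φ n))) (b (s (φ n)))
            ((fun γ : HexDomainSAW D.carrier (s (φ n)) (a (s (φ n))) (b (s (φ n))) => γ.curve) ⁻¹'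
              F) :=
          measure_mono fun γ hγ => hsub fun hmem =>
            hγ (CurveClass.modulusClass_mono le_rfl hnθ.le hmem)
      _ = Q (s (φ n)) F := (Measure.map_apply (hmeas _) hF.measurableSet).symm
      _ = Q' (s (φ n)) F := by rw [hQs n]
  exact lt_irrefl _ (key.trans hnF)

end Summit.CriticalPhenomena.SAWScalingLimit.Theorems.ObservableToSLER.Modulus

end
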